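import Mathlib
import HarnessLib
import Summits.HubbardSuperconductivity.HubbardSuperconductivity.Theorems.KLProgrammeKLRegimeTwoVolumeTowerStepCovZeroPlainL1
import Summits.HubbardSuperconductivity.HubbardSuperconductivity.Theorems.KLProgrammeKLRegimeTwoVolumeTowerStepCovZeroPlainSectional
import Summits.HubbardSuperconductivity.HubbardSuperconductivity.Theorems.KLProgrammeKLRegimeTwoVolumeTowerStepCovZeroIncrL1
import Summits.HubbardSuperconductivity.HubbardSuperconductivity.Theorems.KLProgrammeKLRegimeTwoVolumeTowerStepCovZeroIncrSectional
import Summits.HubbardSuperconductivity.HubbardSuperconductivity.Theorems.KLProgrammeKLRegimeTwoVolumeTowerStepCovZeroGram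
import Summits.HubbardSuperconductivity.HubbardSuperconductivity.Theorems.KLProgrammeKLRegimeTwoVolumeTowerStepCovZeroEntry
import Summits.HubbardSuperconductivity.HubbardSuperconductivity.Theorems.KLProgrammeKLRegimeTwoVolumeTowerStepCovTelescope
import Summits.HubbardSuperconductivity.HubbardSuperconductivity.Theorems.KLProgrammeKLRegimeTwoVolumeTowerStepCovFlowData
import Summits.HubbardSuperconductivity.HubbardSuperconductivity.Theorems.KLProgrammeKLRegimeThinPairFlowData

/-!
# K3 VL child `KLRegimeVolumeLimitV17F2` (stmt-HubbardSuperconductivity-20440), located item «SCALE-0-STEPCOV», part 4 (FLOW, ALL STEPS): the one-volume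
# covariance data of the FIRST step `klStepCov V M β μ K_n 0` — `ScaleCovData … Λw κ₀ (Cα₀·(M/β)) Cs₀` and `ScaleCovSecData … Λw Ce₀` — at EVERY flow frame
# `K_n = klFlowFrameU L M β U μ n`, `1 ≤ n ≤ n_β + 1`, on ANY lattice `V`, with ABSOLUTE constants, whenever the weight rate satisfies `Λw·4ⁿ ≤ ρ₀`

Cell `gate-hubbard-kl`, seat p3 (g17).  This closes the located item «SCALE-0-STEPCOV» (DISCHARGER-GUIDE-g14 §1: the `j = 0` rows of `TowerVolumeDataT(S).cov`
on both volumes and of `TowerCrossData.cov/.sec`), in the same dictionary as the `k ≥ 1` doors `scaleCovData_klStepCov_flow_all` /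
`scaleCovSecData_klStepCov_flow_all` (p3 g16): Gram `isGramBoundedR_klStepCov_zero_of_frameOK` (p620969) and entry `norm_klStepCov_zero_apply_le` (p621764)
made β-free by `(Λ₁β/π + 3)/β ≤ Λ₁/π + 3/128`; rows / columns / sectional rows by the FRAME TELESCOPE at scale `0`
`klStepCov[K_{1+d}] 0 = klStepCov[K_1] 0 + Σ_{i<d} (klStepCov[K_{2+i}] 0 − klStepCov[K_{1+i}] 0)` (p3 g13 `sum_norm_chain_le_of_steps`): the base at `K_1`
(`‖D³e_{K_1}‖ ≤ 65·4 = 260`) is parts 2b/2c (`plainSlice_wt_l1_le / _sectional_le 260`) through part 1's `rowSumWt_/colSumWt_/secRowWt_klStepCov_zero_le'`,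
and the piece `K_{1+i} → K_{2+i}` (jets `flowPiece_increment_jets_G₀` at `x = 4^{1+i}`, `G₀ = (ΣGfr+1)U ≤ 1`, `‖D³e_{K_{1+i}}‖ ≤ 65·4^{1+i}`) is parts 3b/3c
(`incrSlice_wt_l1_le / _sectional_le 65`) through part 1's `…_klStepCov_zero_sub_le`; the pieces decay like `4^{−(1+i)}` (`Σ ≤ 1/3`) at the rate condition
`Λw·4ⁿ ≤ ρ₀ := min of the four rates`.

* §0 helpers: `geom_quarter_tail_le` (`Σ_{i<d} (4^{1+i})⁻¹ ≤ 1/3`), `third_deriv_frameLevel_klFlowFrameU_le_scaled` (`‖D³e_{K_m}‖ ≤ 65·4^m`, `m ≥ 1`);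
* §1 **`rowColSumWt_klStepCov_zero_flow`** — `∃ Cα ρ₀ > 0`: rows and columns of `klStepCov V M β μ K_n 0` in the `(1 + Λw·tnorm)` currency `≤ Cα·(M/β)`;
* §2 **`scaleCovData_klStepCov_zero_flow_all`** — the `ScaleCovData` door;
* (part 4b `…StepCovZeroSecFlowAllSteps`) `secRowSumWt_klStepCov_zero_flow`, `scaleCovSecData_klStepCov_zero_flow_all` — the sectional door (ε-free).

Everything is proved; no definitions, no sorry.  Nothing asserts any stub, K3, VL or superconductivity.
[cite: BenfattoGiulianiMastropietro2006, §2.7 (2.66)–(2.67), §2.8 (2.80)–(2.81), §3 (3.2)–(3.8)]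
-/

noncomputable section

namespace Summit.HubbardSuperconductivity.HubbardSuperconductivity.Theorems.TorusFourierL2

set_option linter.dupNamespace false -- summit = problem name (single-conjunct summit), D-0017

open Set Finset Literature.MathematicalPhysics.QuantumLattice Literature.MathematicalPhysics.QuantumLattice.BandSectorCounting
open Literature.MathematicalPhysics.QuantumLattice.FermiRG Literature.Probability.LatticeModels Literature.Analysis.SpecialFunctions
open Summit.HubbardSuperconductivity.HubbardSuperconductivity.Theorems.DispersionFlow
open Summit.HubbardSuperconductivity.HubbardSuperconductivity.Theorems.KLRegimeSplit
open Summit.HubbardSuperconductivity.HubbardSuperconductivity.Theorems.KLProgrammeLegKernels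
open Summit.HubbardSuperconductivity.HubbardSuperconductivity.Theorems.PerturbedFermiCurve
open Summit.HubbardSuperconductivity.HubbardSuperconductivity.Theorems.KLRegimeWick
open Summit.HubbardSuperconductivity.HubbardSuperconductivity.Theorems.TwoVolumeSource
open Summit.HubbardSuperconductivity.HubbardSuperconductivity.Theorems.TwoVolumeDefect
open scoped Real Nat

open Classical

/-! ## §0 Helpers -/

section Helpers

/-- The geometric tail `Σ_{i<d} (4^{1+i})⁻¹ ≤ 1/3`. [folklore] -/
theorem geom_quarter_tail_le (d : ℕ) : ∑ i ∈ range d, ((4 : ℝ) ^ (1 + i))⁻¹ ≤ 1 / 3 := by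
  have h : ∀ d : ℕ, ∑ i ∈ range d, ((4 : ℝ) ^ (1 + i))⁻¹ ≤ 1 / 3 - ((4 : ℝ) ^ d)⁻¹ / 3 := by
    intro d
    induction d with
    | zero => simp
    | succ d ih =>
      rw [Finset.sum_range_succ, pow_succ, show 1 + d = d + 1 by omega, pow_succ, mul_inv]
      nlinarith [ih, inv_pos.2 (pow_pos (by norm_num : (0 : ℝ) < 4) d)]
  have h0 : 0 ≤ ((4 : ℝ) ^ d)⁻¹ / 3 := by positivity
  linarith [h d]

variable {L M : ℕ} [NeZero L] [NeZero M]

/-- **`‖D³e_{K_m}‖ ≤ 65·4^m` along the flow** (`1 ≤ m`; from `64 + Gfr₃U²·4^m/3` with `Gfr₃·U ≤ 1`, `U ≤ 1`). [cite: BenfattoGiulianiMastropietro2006, §3 (3.2)] -/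
theorem third_deriv_frameLevel_klFlowFrameU_le_scaled {β U μ : ℝ} {R : RenConsts} (hR : ∀ j, 0 ≤ R.Gfr j) (hU : 0 ≤ U) (hU1 : U ≤ 1)
    (hGU : R.Gfr 3 * U ≤ 1) {m : ℕ} (hJ : ∀ m' < m, FlowPieceJetsAt L M β U μ R m') (p : Momentum) :
    ‖iteratedFDeriv ℝ 3 (frameLevel μ (klFlowFrameU L M β U μ m)) p‖ ≤ 65 * (4 : ℝ) ^ m := by
  refine (norm_iteratedFDeriv_three_frameLevel_klFlowFrameU_le hR hJ p).trans ?_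
  have h4 : (1 : ℝ) ≤ (4 : ℝ) ^ m := one_le_pow₀ (by norm_num)
  have h1 : R.Gfr 3 * U ^ 2 ≤ 1 := by nlinarith [hR 3]
  have h2 : R.Gfr 3 * U ^ 2 * ((4 : ℝ) ^ m / 3) ≤ (4 : ℝ) ^ m / 3 :=
    mul_le_of_le_one_left (by positivity) h1
  linarith

end Helpers

/-! ## §1 Weighted rows and columns of the first step covariance along the flow -/

section RowsCols

set_option maxHeartbeats 4000000 in -- long binder lists of the four suppliers and the chain bookkeeping
/-- **Rows and columns of `klStepCov V M β μ K_n 0` in the `(1 + Λw·tnorm)` currency, every flow frame, absolute constant `Cα·(M/β)`, rate condition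
`Λw·4ⁿ ≤ ρ₀`** (frame telescope at scale `0`; see the module docstring). [cite: BenfattoGiulianiMastropietro2006, §2.8 (2.81), §3 (3.2)–(3.8)] -/
theorem rowColSumWt_klStepCov_zero_flow :
    ∃ Cα ρ₀ : ℝ, 0 < Cα ∧ 0 < ρ₀ ∧
      ∀ (G : GeoConsts) (P : SplitConsts) (R : RenConsts) (Q : EngConsts) (cc : ℝ), R.WF2 →
      ∀ (μ U : ℝ), 0 < U → U ≤ min (EngineV8.klEngU₀3 P R cc) (1 / (R.Gfr 3 + 1)) →
      ∀ β : ℝ, klBetaMin ≤ β →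
      ∀ (L M : ℕ) [NeZero L] [NeZero M],
      ∀ n : ℕ, 1 ≤ n → n ≤ nScales β + 1 → HistP klPredsV17F2 L M G P Q R β U μ 0 n →
        ∀ (V : ℕ) [NeZero V], EngineV8.klEngL₃ β U ≤ V → EngineV8.klEngM₃ β U V ≤ M →
        ∀ Λw : ℝ, 0 ≤ Λw → Λw * (4 : ℝ) ^ n ≤ ρ₀ →
        (∀ X : SpaceTimeIdx V M × SectorLeg (sectorCount 0), ∑ Y : SpaceTimeIdx V M × SectorLeg (sectorCount 0),
            ‖klStepCov V M β μ (klFlowFrameU L M β U μ n) 0 X Y‖ * (1 + Λw * (Torus.tnorm (X.1.2 - Y.1.2) : ℝ)) ≤ Cα * ((M : ℝ) / β)) ∧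
        (∀ Y : SpaceTimeIdx V M × SectorLeg (sectorCount 0), ∑ X : SpaceTimeIdx V M × SectorLeg (sectorCount 0),
            ‖klStepCov V M β μ (klFlowFrameU L M β U μ n) 0 X Y‖ * (1 + Λw * (Torus.tnorm (X.1.2 - Y.1.2) : ℝ)) ≤ Cα * ((M : ℝ) / β)) := by
  obtain ⟨Cb, sb, hCb, hsb, -, hbase⟩ := plainSlice_wt_l1_le 260 (by norm_num)
  obtain ⟨Cd, sd, hCd, hsd, -, hincr⟩ := incrSlice_wt_l1_le 65 (by norm_num)
  refine ⟨16 * Cb + 16 * Cd / 3, min sb sd, by positivity, lt_min hsb hsd, ?_⟩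
  intro G P R Q cc hR2 μ U hU hUle β hβmin L M _ _ n hn1 hnN hhist V _ hV3 hVM3 Λw hΛw0 hΛwρ
  have hRj : ∀ j, 0 ≤ R.Gfr j := EngineV8.gfr_nonneg_of_wf2 hR2
  have hβ0 : 0 < β := pos_of_klBetaMin_le hβmin
  have hMβ : β ≤ (M : ℝ) := EngineV8.le_of_klEngM₃_le hβmin hV3 hVM3
  have hM0 : (0 : ℝ) < M := lt_of_lt_of_le hβ0 hMβ
  have hU₀ : U ≤ EngineV8.klEngU₀3 P R cc := hUle.trans (min_le_left _ _)
  have hUG : U ≤ 1 / (R.Gfr 3 + 1) := hUle.trans (min_le_right _ _)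
  have hGU : R.Gfr 3 * U ≤ 1 := by
    have hG3 := hRj 3
    calc R.Gfr 3 * U ≤ R.Gfr 3 * (1 / (R.Gfr 3 + 1)) := mul_le_mul_of_nonneg_left hUG hG3
      _ = R.Gfr 3 / (R.Gfr 3 + 1) := by ring
      _ ≤ 1 := by rw [div_le_one (by positivity)]; linarith only [hG3]
  obtain ⟨hG₀pos, hG₀1⟩ := sumGfr_mul_le_one_of_le_klEngU₀3 P hRj hU hU₀
  set G₀ : ℝ := (R.Gfr 0 + R.Gfr 1 + R.Gfr 2 + R.Gfr 3 + 1) * U with hG₀def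
  have hU1 : U ≤ 1 := by
    have h1 : 1 ≤ R.Gfr 0 + R.Gfr 1 + R.Gfr 2 + R.Gfr 3 + 1 := by linarith [hRj 0, hRj 1, hRj 2, hRj 3]
    nlinarith
  have hh := (histP_klPredsV17F2_iff L M G P Q R β U μ 0 n).1 hhist
  have hJ : ∀ m' < n, FlowPieceJetsAt L M β U μ R m' := fun m' hm' => (hh m' hm').2.1.2.1
  -- the rates: `Λw ≤ Λw·4ⁿ ≤ ρ₀`
  have h4n : (1 : ℝ) ≤ (4 : ℝ) ^ n := one_le_pow₀ (by norm_num)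
  have hΛwρ' : Λw ≤ min sb sd := (le_mul_of_one_le_right hΛw0 h4n).trans hΛwρ
  have hΛwb : Λw ≤ 1 * sb := by rw [one_mul]; exact hΛwρ'.trans (min_le_left _ _)
  -- the chain `A i = klStepCov[K_i] 0`, base `m₀ = 1`, `n = 1 + d`
  obtain ⟨d, rfl⟩ : ∃ d, n = 1 + d := ⟨n - 1, by omega⟩
  set A : ℕ → Matrix (SpaceTimeIdx V M × SectorLeg (sectorCount 0)) (SpaceTimeIdx V M × SectorLeg (sectorCount 0)) ℂ :=
    fun i => klStepCov V M β μ (klFlowFrameU L M β U μ i) 0 with hAdef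
  -- the base frame `K_1`
  have hK1 : FrameOK R U (nScales β) μ (klFlowFrameU L M β U μ 1) := frameOK_klFlowFrameU_of_histP_le hR2 le_rfl hn1 (by omega) hhist
  have hK3base : ∀ p : Momentum, ‖iteratedFDeriv ℝ 3 (frameLevel μ (klFlowFrameU L M β U μ 1)) p‖ ≤ 260 := fun p => by
    have h := third_deriv_frameLevel_klFlowFrameU_le_scaled (L := L) (M := M) (β := β) (μ := μ) hRj hU.le hU1 hGU (m := 1)
      (fun m' hm' => hJ m' (by omega)) p
    norm_num at h
    exact h
  have hTb := hbase V M R U (nScales β) μ (klFlowFrameU L M β U μ 1) hK1 hK3base β hβmin hMβ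
  -- the base bound in the `(1 + Λw·tnorm)` currency
  have hTb' : ∑ z : TorusSite 1 (2 * M) × TorusSite 2 V, (1 + Λw * (Torus.tnorm z.2 : ℝ)) *
      ‖∑ q : TorusSite 1 (2 * M) × TorusSite 2 V, (torusChar q.1 z.1 * torusChar q.2 z.2) •
        ((((1 / (β * (V : ℝ) ^ 2) : ℝ) : ℂ) ^ 2 *
          sliceSymbolFnXi (β * (V : ℝ) ^ 2) 0 (klScale klE0 2) (klScale klE0 1) (matsubaraFreq β M ⟨(q.1 0).val, ZMod.val_lt (q.1 0)⟩)
            (nambuXiCT V μ (klFlowFrameU L M β U μ 1) q.2)))‖ ≤ Cb * ((M : ℝ) / β) := by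
    refine le_trans (Finset.sum_le_sum fun z _ => mul_le_mul_of_nonneg_right ?_ (norm_nonneg _)) hTb
    have h := one_add_mul_tnorm_le_mul_rateWt (L := V) le_rfl hΛw0 hΛwb z.2
    rw [one_mul] at h
    exact h
  -- the pieces `K_{1+i} → K_{2+i}`, `i < d`
  have hpiece : ∀ i < d, ∑ z : TorusSite 1 (2 * M) × TorusSite 2 V, (1 + Λw * (Torus.tnorm z.2 : ℝ)) *
      ‖∑ q : TorusSite 1 (2 * M) × TorusSite 2 V, (torusChar q.1 z.1 * torusChar q.2 z.2) •
        ((((1 / (β * (V : ℝ) ^ 2) : ℝ) : ℂ) ^ 2 *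
          (sliceSymbolFnXi (β * (V : ℝ) ^ 2) 0 (klScale klE0 2) (klScale klE0 1) (matsubaraFreq β M ⟨(q.1 0).val, ZMod.val_lt (q.1 0)⟩)
              (nambuXiCT V μ (klFlowFrameU L M β U μ (1 + i + 1)) q.2) -
            sliceSymbolFnXi (β * (V : ℝ) ^ 2) 0 (klScale klE0 2) (klScale klE0 1) (matsubaraFreq β M ⟨(q.1 0).val, ZMod.val_lt (q.1 0)⟩)
              (nambuXiCT V μ (klFlowFrameU L M β U μ (1 + i)) q.2))))‖ ≤ Cd * ((M : ℝ) / β) * (G₀ / (4 : ℝ) ^ (1 + i)) := by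
    intro i hi
    obtain ⟨hfr1, hfr2, -, -, -, -, hJi, -⟩ := thinPair_flow_frames hR2 hnN hhist (i := 1 + i) (by omega) (by omega)
    have hx : (1 : ℝ) ≤ (4 : ℝ) ^ (1 + i) := one_le_pow₀ (by norm_num)
    have hK3 : ∀ p : Momentum, ‖iteratedFDeriv ℝ 3 (frameLevel μ (klFlowFrameU L M β U μ (1 + i))) p‖ ≤ 65 * (4 : ℝ) ^ (1 + i) := fun p =>
      third_deriv_frameLevel_klFlowFrameU_le_scaled (L := L) (M := M) (β := β) (μ := μ) hRj hU.le hU1 hGU (fun m' hm' => hJ m' (by omega)) p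
    obtain ⟨hw₀, hw₁, hw₂, hw₃⟩ := flowPiece_increment_jets_G₀ (L := L) (M := M) (μ := μ) hRj hU hU1 hJi
    have hT := hincr V M R U (nScales β) R U (nScales β) μ (klFlowFrameU L M β U μ (1 + i)) (klFlowFrameU L M β U μ (1 + i + 1)) hfr1 hfr2
      G₀ ((4 : ℝ) ^ (1 + i)) hG₀pos.le hG₀1 hx hK3 hw₀ hw₁ hw₂ hw₃ β hβmin hMβ
    refine le_trans (Finset.sum_le_sum fun z _ => mul_le_mul_of_nonneg_right ?_ (norm_nonneg _)) hT
    have hΛwi : Λw ≤ 1 * (sd / (4 : ℝ) ^ (1 + i)) := by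
      rw [one_mul, le_div_iff₀ (by positivity)]
      have h1 : Λw * (4 : ℝ) ^ (1 + i) ≤ Λw * (4 : ℝ) ^ (1 + d) :=
        mul_le_mul_of_nonneg_left (pow_le_pow_right₀ (by norm_num) (by omega)) hΛw0
      exact h1.trans (hΛwρ.trans (min_le_right _ _))
    have h := one_add_mul_tnorm_le_mul_rateWt (L := V) le_rfl hΛw0 hΛwi z.2
    rw [one_mul] at h
    exact h
  -- the geometric sum of the pieces
  have hsum : ∑ i ∈ range d, 16 * (Cd * ((M : ℝ) / β) * (G₀ / (4 : ℝ) ^ (1 + i))) ≤ 16 * Cd / 3 * ((M : ℝ) / β) := by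
    have e : ∑ i ∈ range d, 16 * (Cd * ((M : ℝ) / β) * (G₀ / (4 : ℝ) ^ (1 + i))) =
        16 * Cd * ((M : ℝ) / β) * G₀ * ∑ i ∈ range d, ((4 : ℝ) ^ (1 + i))⁻¹ := by
      rw [Finset.mul_sum]; exact Finset.sum_congr rfl fun i _ => by rw [div_eq_mul_inv]; ring
    rw [e]
    have hg := geom_quarter_tail_le d
    have h0 : 0 ≤ 16 * Cd * ((M : ℝ) / β) := by positivity
    calc 16 * Cd * ((M : ℝ) / β) * G₀ * ∑ i ∈ range d, ((4 : ℝ) ^ (1 + i))⁻¹ ≤ 16 * Cd * ((M : ℝ) / β) * 1 * (1 / 3) := by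
          gcongr
      _ = 16 * Cd / 3 * ((M : ℝ) / β) := by ring
  -- the weight on the product torus is even
  have hwev : ∀ (a : TorusSite 1 (2 * M)) (b : TorusSite 2 V), (fun z : TorusSite 1 (2 * M) × TorusSite 2 V => 1 + Λw * (Torus.tnorm z.2 : ℝ)) (-a, -b) =
      (fun z : TorusSite 1 (2 * M) × TorusSite 2 V => 1 + Λw * (Torus.tnorm z.2 : ℝ)) (a, b) := fun a b => one_add_mul_tnorm_neg Λw b
  have hw0 : ∀ z : TorusSite 1 (2 * M) × TorusSite 2 V, 0 ≤ (fun z : TorusSite 1 (2 * M) × TorusSite 2 V => 1 + Λw * (Torus.tnorm z.2 : ℝ)) z :=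
    fun z => by positivity
  refine ⟨fun X => ?_, fun Y => ?_⟩
  · -- rows: the chain sampled at `(X, ·)`
    have hchain := sum_norm_chain_le_of_steps A (univ : Finset (SpaceTimeIdx V M × SectorLeg (sectorCount 0))) (fun _ => X) (fun Y => Y)
      (fun Y => 1 + Λw * (Torus.tnorm (X.1.2 - Y.1.2) : ℝ)) (fun Y => by positivity) 1 d
      (fun i => 16 * (Cd * ((M : ℝ) / β) * (G₀ / (4 : ℝ) ^ (1 + i)))) (fun i hi => by
        simp only [hAdef]
        exact rowSumWt_klStepCov_zero_sub_le hβ0.ne' μ _ _ _ hw0 hwev (hpiece i hi) X)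
    have hb := rowSumWt_klStepCov_zero_le' (V := V) (M := M) hβ0.ne' μ (klFlowFrameU L M β U μ 1) _ hw0 hwev hTb' X
    simp only [hAdef] at hchain hb
    calc _ ≤ _ := hchain
      _ ≤ 16 * (Cb * ((M : ℝ) / β)) + 16 * Cd / 3 * ((M : ℝ) / β) := add_le_add hb hsum
      _ = (16 * Cb + 16 * Cd / 3) * ((M : ℝ) / β) := by ring
  · -- columns: the chain sampled at `(·, Y)`
    have hchain := sum_norm_chain_le_of_steps A (univ : Finset (SpaceTimeIdx V M × SectorLeg (sectorCount 0))) (fun X => X) (fun _ => Y)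
      (fun X => 1 + Λw * (Torus.tnorm (X.1.2 - Y.1.2) : ℝ)) (fun X => by positivity) 1 d
      (fun i => 16 * (Cd * ((M : ℝ) / β) * (G₀ / (4 : ℝ) ^ (1 + i)))) (fun i hi => by
        simp only [hAdef]
        exact colSumWt_klStepCov_zero_sub_le hβ0.ne' μ _ _ _ hw0 hwev (hpiece i hi) Y)
    have hb := colSumWt_klStepCov_zero_le (V := V) (M := M) hβ0.ne' μ (klFlowFrameU L M β U μ 1) _ hw0 hwev hTb' Y
    simp only [hAdef] at hchain hb
    calc _ ≤ _ := hchain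
      _ ≤ 16 * (Cb * ((M : ℝ) / β)) + 16 * Cd / 3 * ((M : ℝ) / β) := add_le_add hb hsum
      _ = (16 * Cb + 16 * Cd / 3) * ((M : ℝ) / β) := by ring

end RowsCols

/-! ## §2 The `ScaleCovData` door at scale `0` -/

section Door

set_option maxHeartbeats 800000 in -- long binder list
/-- **THE ONE-VOLUME COVARIANCE DATA OF THE FIRST STEP AT EVERY FLOW FRAME** (located item «SCALE-0-STEPCOV», DISCHARGER-GUIDE-g14 §1 `.cov` at `j = 0`):
`∃ Cκ₀ Cα₀ Cs₀ ρ₀ > 0`, for every history `HistP klPredsV17F2 … 0 n` (`1 ≤ n ≤ n_β + 1`), every lattice `V` with `klEngL₃ β U ≤ V`, `klEngM₃ β U V ≤ M`, every rate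
`0 ≤ Λw` with `Λw·4ⁿ ≤ ρ₀`: `ScaleCovData (klStepCov V M β μ (klFlowFrameU L M β U μ n) 0) Λw Cκ₀ (Cα₀·(M/β)) Cs₀` — Gram `isGramBoundedR_klStepCov_zero_of_frameOK`
(p620969), entry `norm_klStepCov_zero_apply_le` (p621764), rows/columns §1. [cite: BenfattoGiulianiMastropietro2006, §2.8 (2.80)–(2.81), §3 (3.2)–(3.8)] -/
theorem scaleCovData_klStepCov_zero_flow_all :
    ∃ Cκ₀ Cα₀ Cs₀ ρ₀ : ℝ, 0 < Cκ₀ ∧ 0 < Cα₀ ∧ 0 < Cs₀ ∧ 0 < ρ₀ ∧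
      ∀ (G : GeoConsts) (P : SplitConsts) (R : RenConsts) (Q : EngConsts) (cc : ℝ), R.WF2 →
      ∀ (μ U : ℝ), 0 < U → U ≤ min (EngineV8.klEngU₀3 P R cc) (1 / (R.Gfr 3 + 1)) →
      ∀ β : ℝ, klBetaMin ≤ β →
      ∀ (L M : ℕ) [NeZero L] [NeZero M],
      ∀ n : ℕ, 1 ≤ n → n ≤ nScales β + 1 → HistP klPredsV17F2 L M G P Q R β U μ 0 n →
        ∀ (V : ℕ) [NeZero V], EngineV8.klEngL₃ β U ≤ V → EngineV8.klEngM₃ β U V ≤ M →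
        ∀ Λw : ℝ, 0 ≤ Λw → Λw * (4 : ℝ) ^ n ≤ ρ₀ →
          ScaleCovData (klStepCov V M β μ (klFlowFrameU L M β U μ n) 0) Λw
            (Real.sqrt (8 * (klScale klE0 1 / Real.pi + 3 / 128) * (1793 * klScale klE0 1 + 704) / klScale klE0 1)) (Cα₀ * ((M : ℝ) / β))
            (8 * (klScale klE0 1 / Real.pi + 3 / 128) * (1793 * klScale klE0 1 + 704) / klScale klE0 1) := by
  obtain ⟨Cα, ρ₀, hCα, hρ₀, hrc⟩ := rowColSumWt_klStepCov_zero_flow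
  have hΛ1 : 0 < klScale klE0 1 := klth_klScale_pos 1
  have hCs : 0 < 8 * (klScale klE0 1 / Real.pi + 3 / 128) * (1793 * klScale klE0 1 + 704) / klScale klE0 1 := by positivity
  refine ⟨_, Cα, _, ρ₀, Real.sqrt_pos.2 hCs, hCα, hCs, hρ₀, ?_⟩
  intro G P R Q cc hR2 μ U hU hUle β hβmin L M _ _ n hn1 hnN hhist V _ hV3 hVM3 Λw hΛw0 hΛwρ
  have hβ0 : 0 < β := pos_of_klBetaMin_le hβmin
  have hβ128 : (128 : ℝ) ≤ β := by simpa [klBetaMin] using hβmin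
  have hMβ : β ≤ (M : ℝ) := EngineV8.le_of_klEngM₃_le hβmin hV3 hVM3
  have hM0 : (0 : ℝ) < M := lt_of_lt_of_le hβ0 hMβ
  have hfr : FrameOK R U (nScales β) μ (klFlowFrameU L M β U μ n) := frameOK_klFlowFrameU_of_histP_le hR2 hn1 le_rfl hnN hhist
  obtain ⟨hrow, hcol⟩ := hrc G P R Q cc hR2 μ U hU hUle β hβmin L M n hn1 hnN hhist V hV3 hVM3 Λw hΛw0 hΛwρ
  -- the β-dependent Gram / entry constant is below the β-free one
  have hconst : 8 * (klScale klE0 1 * β / Real.pi + 3) * (1793 * klScale klE0 1 + 704) / (β * klScale klE0 1) ≤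
      8 * (klScale klE0 1 / Real.pi + 3 / 128) * (1793 * klScale klE0 1 + 704) / klScale klE0 1 := by
    rw [div_le_div_iff₀ (by positivity) hΛ1]
    have h1 : klScale klE0 1 * β / Real.pi + 3 ≤ β * (klScale klE0 1 / Real.pi + 3 / 128) := by
      rw [mul_add]
      have : (3 : ℝ) ≤ β * (3 / 128) := by linarith
      have e : klScale klE0 1 * β / Real.pi = β * (klScale klE0 1 / Real.pi) := by ring
      linarith
    have h2 : 0 ≤ 8 * (1793 * klScale klE0 1 + 704) * klScale klE0 1 * klScale klE0 1 := by positivity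
    calc 8 * (klScale klE0 1 * β / Real.pi + 3) * (1793 * klScale klE0 1 + 704) * klScale klE0 1
        ≤ 8 * (β * (klScale klE0 1 / Real.pi + 3 / 128)) * (1793 * klScale klE0 1 + 704) * klScale klE0 1 := by gcongr
      _ = 8 * (klScale klE0 1 / Real.pi + 3 / 128) * (1793 * klScale klE0 1 + 704) * (β * klScale klE0 1) := by ring
  exact
    { κ_pos := Real.sqrt_pos.2 hCs
      gram := (isGramBoundedR_klStepCov_zero_of_frameOK (V := V) (M := M) hfr hβ0).mono (Real.sqrt_nonneg _) (Real.sqrt_le_sqrt hconst)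
      αW_pos := by positivity
      row := hrow
      col := hcol
      sW_nonneg := hCs.le
      entry := fun X Y => (norm_klStepCov_zero_apply_le (V := V) (M := M) hfr hβ0 X Y).trans hconst }

end Door

end Summit.HubbardSuperconductivity.HubbardSuperconductivity.Theorems.TorusFourierL2

end
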